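import Mathlib
import Summits.NavierStokesRegularity.NavierStokesRegularity.Theorems.FilamentSkeletonRssStadiumKernelPieces
import Summits.NavierStokesRegularity.NavierStokesRegularity.Theorems.FilamentSkeletonRssStadiumHolomorphicIntegral

/-!
# Route `FilamentSkeletonRss` · child crux `TangentSkeletonNearStraightL` (stmt-NavierStokesRegularity-23320) · registered line
# `child_tangent_analytic_strip_L` (b0b56c52900dd90a), stub `stub_stripPropagation` — brick: THE NEAR-DIAGONAL PIECE IS HOLOMORPHIC

First assembly step of R7 (STUB-PLAN memo attached to 23320).  With `F : ℂ → ℂ³` (the stadium-analytic curve) and `G : ℂ → ℂ` (the stadium-analytic core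
area) holomorphic on an open `S`, an open `V` and `R` such that `z + s ∈ S` for `z ∈ V`, `s ∈ [[−R, R]]`, and the PRINCIPAL-BRANCH CONDITION
`0 < Re(Q(z,s) + κ·G(z+s))` there (`Q(z,s) = Σᵢ(Fᵢ(z+s) − Fᵢ(z))²`; supplied by `Theorems.StadiumChord` + the core-area floor), the shifted near-diagonal
piece of the continued matched Biot–Savart field,
`z ↦ ∫_{−R}^{R} ((Q(z,s) + κ G(z+s))^{3/2})⁻¹ • (F′(z+s) ⨯₃ (F(z) − F(z+s))) ds`,
is holomorphic on `V` (`differentiableOn_nearPiece`): joint continuity + separate holomorphy of the kernel (`Theorems.StadiumKernelPieces` for the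
power, coordinate polynomials for `⨯₃`) and `Theorems.StadiumHolomorphicIntegral.differentiableOn_intervalIntegral_of_continuousOn` (p817883).
HONEST FRAMING: a brick for a plan about a HYPOTHETICAL filament skeleton on the NEGATIVE side of a MODEL route; the stub `stub_stripPropagation` is NOT
closed; nothing here bears on Navier–Stokes regularity or blow-up.  `--supports stmt-NavierStokesRegularity-23320`.
-/

set_option linter.dupNamespace false

noncomputable section

namespace Summit.NavierStokesRegularity.NavierStokesRegularity.Theorems.StadiumNearPieceHolomorphic

open Set Filter Topology Complex
open scoped Matrix

/-- Coordinates of the cross product on `ℂ³` are continuous bilinear polynomials: if `a, b : X → ℂ³` are continuous on `T`, so is `a ⨯₃ b`. [folklore] -/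
theorem ContinuousOn.crossProduct {X : Type*} [TopologicalSpace X] {a b : X → (Fin 3 → ℂ)} {T : Set X}
    (ha : ContinuousOn a T) (hb : ContinuousOn b T) : ContinuousOn (fun x => a x ⨯₃ b x) T := by
  have hai : ∀ i, ContinuousOn (fun x => a x i) T := fun i => (continuous_apply i).comp_continuousOn ha
  have hbi : ∀ i, ContinuousOn (fun x => b x i) T := fun i => (continuous_apply i).comp_continuousOn hb
  refine continuousOn_pi.2 fun i => ?_
  fin_cases i
  · simpa [cross_apply, Pi.mul_def, Pi.sub_def] using ((hai 1).mul (hbi 2)).sub ((hai 2).mul (hbi 1))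
  · simpa [cross_apply, Pi.mul_def, Pi.sub_def] using ((hai 2).mul (hbi 0)).sub ((hai 0).mul (hbi 2))
  · simpa [cross_apply, Pi.mul_def, Pi.sub_def] using ((hai 0).mul (hbi 1)).sub ((hai 1).mul (hbi 0))

/-- If `a, b : ℂ → ℂ³` are holomorphic on `V`, so is `a ⨯₃ b`. [folklore] -/
theorem DifferentiableOn.crossProduct {a b : ℂ → (Fin 3 → ℂ)} {V : Set ℂ}
    (ha : DifferentiableOn ℂ a V) (hb : DifferentiableOn ℂ b V) : DifferentiableOn ℂ (fun x => a x ⨯₃ b x) V := by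
  have hai : ∀ i, DifferentiableOn ℂ (fun x => a x i) V := fun i => differentiableOn_pi.1 ha i
  have hbi : ∀ i, DifferentiableOn ℂ (fun x => b x i) V := fun i => differentiableOn_pi.1 hb i
  refine differentiableOn_pi.2 fun i => ?_
  fin_cases i
  · simpa [cross_apply, Pi.mul_def, Pi.sub_def] using ((hai 1).mul (hbi 2)).sub ((hai 2).mul (hbi 1))
  · simpa [cross_apply, Pi.mul_def, Pi.sub_def] using ((hai 2).mul (hbi 0)).sub ((hai 0).mul (hbi 2))
  · simpa [cross_apply, Pi.mul_def, Pi.sub_def] using ((hai 0).mul (hbi 1)).sub ((hai 1).mul (hbi 0))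

/-- **The near-diagonal piece is holomorphic.**  See the module docstring. [folklore] -/
theorem differentiableOn_nearPiece {S V : Set ℂ} (hS : IsOpen S) (hV : IsOpen V) {F : ℂ → (Fin 3 → ℂ)} {G : ℂ → ℂ}
    (hF : DifferentiableOn ℂ F S) (hG : DifferentiableOn ℂ G S) {κ R : ℝ}
    (hseg : ∀ z ∈ V, ∀ s ∈ Set.uIcc (-R) R, z + (s : ℂ) ∈ S) (hVS : V ⊆ S)
    (hpos : ∀ z ∈ V, ∀ s ∈ Set.uIcc (-R) R,
      0 < ((∑ i, (F (z + (s : ℂ)) i - F z i) ^ 2) + (κ : ℂ) * G (z + (s : ℂ))).re) :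
    DifferentiableOn ℂ (fun z => ∫ s in (-R)..R,
      ((((∑ i, (F (z + (s : ℂ)) i - F z i) ^ 2) + (κ : ℂ) * G (z + (s : ℂ))) ^ ((3:ℂ) / 2))⁻¹ •
        (deriv F (z + (s : ℂ)) ⨯₃ (F z - F (z + (s : ℂ)))))) V := by
  -- holomorphy / continuity of the ingredients
  have hFan : AnalyticOnNhd ℂ F S := hF.analyticOnNhd hS
  have hdF : DifferentiableOn ℂ (deriv F) S := hFan.deriv.differentiableOn
  have hFc : ContinuousOn F S := hF.continuousOn
  have hdFc : ContinuousOn (deriv F) S := hdF.continuousOn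
  have hGc : ContinuousOn G S := hG.continuousOn
  -- the shift map `(z, s) ↦ z + s` and `z ↦ z + s`
  have hshift2 : ContinuousOn (fun p : ℂ × ℝ => p.1 + (p.2 : ℂ)) (V ×ˢ Set.uIcc (-R) R) :=
    (continuous_fst.add (Complex.continuous_ofReal.comp continuous_snd)).continuousOn
  have hmaps2 : MapsTo (fun p : ℂ × ℝ => p.1 + (p.2 : ℂ)) (V ×ˢ Set.uIcc (-R) R) S :=
    fun p hp => hseg p.1 hp.1 p.2 hp.2
  have hfst : MapsTo (fun p : ℂ × ℝ => p.1) (V ×ˢ Set.uIcc (-R) R) S := fun p hp => hVS hp.1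
  -- the scalar base `w(z,s) = Q + κ G` as a function of `(z, s)` and of `z`
  set W : ℂ → ℝ → ℂ := fun z s => (∑ i, (F (z + (s : ℂ)) i - F z i) ^ 2) + (κ : ℂ) * G (z + (s : ℂ)) with hW
  set Num : ℂ → ℝ → (Fin 3 → ℂ) := fun z s => deriv F (z + (s : ℂ)) ⨯₃ (F z - F (z + (s : ℂ))) with hNum
  -- joint continuity
  have hWc : ContinuousOn (Function.uncurry W) (V ×ˢ Set.uIcc (-R) R) := by
    have h1 : ContinuousOn (fun p : ℂ × ℝ => F (p.1 + (p.2 : ℂ))) (V ×ˢ Set.uIcc (-R) R) := hFc.comp hshift2 hmaps2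
    have h2 : ContinuousOn (fun p : ℂ × ℝ => F p.1) (V ×ˢ Set.uIcc (-R) R) := hFc.comp continuous_fst.continuousOn hfst
    have h3 : ContinuousOn (fun p : ℂ × ℝ => G (p.1 + (p.2 : ℂ))) (V ×ˢ Set.uIcc (-R) R) := hGc.comp hshift2 hmaps2
    have h4 : ∀ i, ContinuousOn (fun p : ℂ × ℝ => (F (p.1 + (p.2 : ℂ)) i - F p.1 i) ^ 2) (V ×ˢ Set.uIcc (-R) R) := fun i =>
      (((continuous_apply i).comp_continuousOn h1).sub ((continuous_apply i).comp_continuousOn h2)).pow 2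
    have h5 : ContinuousOn (fun p : ℂ × ℝ => ∑ i, (F (p.1 + (p.2 : ℂ)) i - F p.1 i) ^ 2) (V ×ˢ Set.uIcc (-R) R) :=
      continuousOn_finsetSum _ fun i _ => h4 i
    exact h5.add (continuousOn_const.mul h3)
  have hNc : ContinuousOn (Function.uncurry Num) (V ×ˢ Set.uIcc (-R) R) := by
    have h1 : ContinuousOn (fun p : ℂ × ℝ => deriv F (p.1 + (p.2 : ℂ))) (V ×ˢ Set.uIcc (-R) R) := hdFc.comp hshift2 hmaps2
    have h2 : ContinuousOn (fun p : ℂ × ℝ => F p.1 - F (p.1 + (p.2 : ℂ))) (V ×ˢ Set.uIcc (-R) R) :=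
      (hFc.comp continuous_fst.continuousOn hfst).sub (hFc.comp hshift2 hmaps2)
    exact ContinuousOn.crossProduct h1 h2
  -- the kernel
  have hKc : ContinuousOn (Function.uncurry fun z s => ((W z s) ^ ((3:ℂ) / 2))⁻¹ • Num z s) (V ×ˢ Set.uIcc (-R) R) := by
    have hpow : ContinuousOn (fun p : ℂ × ℝ => ((W p.1 p.2) ^ ((3:ℂ) / 2))⁻¹) (V ×ˢ Set.uIcc (-R) R) := by
      intro p hp
      have hp' : 0 < (W p.1 p.2).re := hpos p.1 hp.1 p.2 hp.2
      have hc : ContinuousAt (fun w : ℂ => (w ^ ((3:ℂ) / 2))⁻¹) (W p.1 p.2) :=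
        (Summit.NavierStokesRegularity.NavierStokesRegularity.Theorems.StadiumKernelPieces.differentiableAt_inv_cpow_threeHalves hp').continuousAt
      exact ContinuousAt.comp_continuousWithinAt (f := Function.uncurry W) hc (hWc p hp)
    exact hpow.smul hNc
  -- separate holomorphy
  have hKd : ∀ s ∈ Set.uIcc (-R) R, DifferentiableOn ℂ (fun z => ((W z s) ^ ((3:ℂ) / 2))⁻¹ • Num z s) V := by
    intro s hs
    have hsh : DifferentiableOn ℂ (fun z : ℂ => z + (s : ℂ)) V := differentiableOn_id.add_const _
    have hmaps : MapsTo (fun z : ℂ => z + (s : ℂ)) V S := fun z hz => hseg z hz s hs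
    have h1 : DifferentiableOn ℂ (fun z => F (z + (s : ℂ))) V := hF.comp hsh hmaps
    have h2 : DifferentiableOn ℂ F V := hF.mono hVS
    have h3 : DifferentiableOn ℂ (fun z => G (z + (s : ℂ))) V := hG.comp hsh hmaps
    have hWd : DifferentiableOn ℂ (fun z => W z s) V := by
      have h4 : ∀ i, DifferentiableOn ℂ (fun z => (F (z + (s : ℂ)) i - F z i) ^ 2) V := fun i =>
        ((differentiableOn_pi.1 h1 i).sub (differentiableOn_pi.1 h2 i)).pow 2
      exact (DifferentiableOn.fun_sum fun i _ => h4 i).add (h3.const_mul _)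
    have hpow : DifferentiableOn ℂ (fun z => ((W z s) ^ ((3:ℂ) / 2))⁻¹) V := by
      intro z hz
      have hp' : 0 < (W z s).re := hpos z hz s hs
      exact DifferentiableAt.comp_differentiableWithinAt (g := fun w : ℂ => (w ^ ((3:ℂ) / 2))⁻¹) (f := fun z => W z s) z
        (Summit.NavierStokesRegularity.NavierStokesRegularity.Theorems.StadiumKernelPieces.differentiableAt_inv_cpow_threeHalves hp') (hWd z hz)
    have hNd : DifferentiableOn ℂ (fun z => Num z s) V :=
      DifferentiableOn.crossProduct (hdF.comp hsh hmaps) (h2.sub h1)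
    exact hpow.smul hNd
  exact Summit.NavierStokesRegularity.NavierStokesRegularity.Theorems.StadiumHolomorphicIntegral.differentiableOn_intervalIntegral_of_continuousOn
    hV hKc hKd

end Summit.NavierStokesRegularity.NavierStokesRegularity.Theorems.StadiumNearPieceHolomorphic

end
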